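import Mathlib.Data.Int.GCD
import Mathlib.Data.Fin.VecNotation
import Mathlib.Data.List.Basic
import Mathlib.Tactic.NormNum
import HarnessLib

/-!
# Local placements of two-shell patterns in close packings — the `√18` integer model, letter contexts and the PAIR CHECK
# (computable; part 1 of 2)

Topic `Literature/Geometry/DiscreteGeometry`, namespace `Literature.Geometry.DiscreteGeometry.TwoShellCheck`; companion of
`TwoShellPatterns.lean` / `TwoShellIntegerModel.lean`.  Requested by the chart step of route
`Summits/AtomisticToContinuum/Crystallization/Theses/PhononSlackCertificates` (crux `NearFieldConvexity`, stub `stub_chartCore`),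
whose finite-geometry content is the folklore crystallography of LOCAL ENVIRONMENTS IN CLOSE PACKINGS: around a site whose
two-shell neighbourhood is the fcc (cuboctahedral) or hcp (anticuboctahedral) 18-point pattern, in which ways can the
two-shell neighbourhood of one of those 18 neighbours sit, given the particles the two neighbourhoods share?  (Hales, *Dense
Sphere Packings* §1.3: successive close-packed layers offer two choices each; Conway–Sloane, *SPLAG* Ch. 4 §6.3 for `D₃`.)
Everything here is COMPUTABLE and meant to be evaluated by the kernel (`decide`); the SOUNDNESS theorems (what a `true`
verdict implies for a real, `1/20`-perturbed configuration) are proved by the consumers.  [folklore]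

**Model.** Points of `ℝ³` of the form `z/√18`, `z ∈ ℤ³`, represented as TRIPLES `ℤ × ℤ × ℤ` (never `Fin 3 → ℤ`: kernel
evaluation must not go through `Matrix.vecCons` or `DecidableEq` of functions).  The two-shell patterns at contact distance
`1` are `fccList` (`= 3·(fccInt ∪ fccSecondShellInt)`) and `hcpList` (`= hcpInt ∪ hcpSecondShellInt`), cf.
`TwoShellIntegerModel` (the bridge `fccTwoShellPattern = image (·/√18)` and the cuboctahedral frame of the ideal Barlow
template).  Squared model distances are integers (`sq`); unit distance ⇔ `18`.

**Letter contexts** (`Ctx`): an ideal Barlow template through the centre, in the cuboctahedral frame, is fixed near the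
centre by one of four coordinate sign flips (which body diagonal is the layer normal) and the letters of layers `−2,−1,1,2`
(`Ctx.isSite`: `6 ∣ Σz`, `z₀ ≡ z₂ ≡ L(Σz/6) + 2Σz/6 (mod 3)` on the flipped vector); `ctxFor t` lists the contexts whose
central 18 sites are exactly the centre's pattern: 16 for an fcc-type centre (13 distinct site sets: all-fcc + 4 normals × 3
letter pairs), 4 for an hcp-type centre.

**The pair check** (`checkPair cenHcp pivHcp z0`): the neighbour at `z0` (witnessed with a pattern of type `pivHcp`) is
compared with the centre through ONE designated triple of common points (`designated`: an all-unit spanning triple, else a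
`(1,1,√2)` one).  The labels given to these three points form an `admissibleLabels` triple (coarse metric classes: norms `1`,
consecutive sides `1`, third side `1`, resp. squared `36/48/54` — a `±(1+s)/10` metric window around `√2`, `s ∈ [47/50,50/47]`,
contains the hcp c-axis pair `48` and misses `54` by `0.008`, so both are admitted); `tripleVerdict` says that EVERY such
triple is either (a) LOCALLY ACCEPTED — the Cramer placement `wₖ ↦ cₖ − z0` is isometric on the pattern, contains every
common exactly and puts no point inside the centre's `1.49`-ball off the centre's pattern — or (b) REFUTABLE for
`1/20`-perturbed data: dependent with a short relation whose image is far from `0`, or some common / some predicted point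
inside the completeness ball sits farther from every image than the crude placement error `ecrD/(940|d|)`
(`|d − Σλ|/20 + Σ|λ|(1+s)/20`, `s ≤ 50/47`) allows.  `checkAllPairs` (all 72 instances) evaluates to `true`.
Part 2 (`TwoShellPlacementCsp.lean`) builds the placements, the pair-consistency predicate, the structural
(constraint-satisfaction) checks and second-stage placement bounds on top of this file.

## Mathlib / tree search
`Matrix.det`, `Matrix.cramer` exist for general matrices (the `Fin 3` formulas are spelled out for kernel evaluation;
`TwoShellIntegerModel.det3Int/cramerInt` are the `Fin 3 → ℤ` versions with the proved Cramer identity); patterns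
`fccInt`, `hcpInt`, `fccSecondShellInt`, `hcpSecondShellInt` (`KissingPatterns`, `TwoShellPatterns`); `LayerShellPatterns.shellTable`
is the analogous integer table for FIRST shells at Hales's scale.  Nothing is redefined; no named fact is introduced.

## References
* T. C. Hales, *Dense Sphere Packings* (2012), §1.3. [HalesDSP2012]
* J. H. Conway, N. J. A. Sloane, *Sphere Packings, Lattices and Groups* (1999), Ch. 4 §6.3. [ConwaySloane1999]
-/

namespace Literature.Geometry.DiscreteGeometry.TwoShellCheck

/-- Integer vectors of `ℤ³` as TRIPLES (the `√18` model: the point of `(x,y,z)` is `(x,y,z)/√18`).  Triples rather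
than `Fin 3 → ℤ`, so that kernel evaluation never goes through `Matrix.vecCons` / `DecidableEq` of functions. [folklore] -/
abbrev IVec := ℤ × ℤ × ℤ

/-- The corresponding function `Fin 3 → ℤ` (for `intVec`). [folklore] -/
def IVec.toFun (z : IVec) : Fin 3 → ℤ := ![z.1, z.2.1, z.2.2]

/-- Squared norm. [folklore] -/
def sq (z : IVec) : ℤ := z.1 * z.1 + z.2.1 * z.2.1 + z.2.2 * z.2.2
/-- Difference. [folklore] -/
def vsub (a b : IVec) : IVec := (a.1 - b.1, a.2.1 - b.2.1, a.2.2 - b.2.2)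
/-- Sum. [folklore] -/
def vadd (a b : IVec) : IVec := (a.1 + b.1, a.2.1 + b.2.1, a.2.2 + b.2.2)
/-- Integer multiple. [folklore] -/
def vsmul (c : ℤ) (a : IVec) : IVec := (c * a.1, c * a.2.1, c * a.2.2)
/-- Componentwise Boolean equality. [folklore] -/
def veq (a b : IVec) : Bool := a.1 == b.1 && a.2.1 == b.2.1 && a.2.2 == b.2.2
/-- List membership through `veq`. [folklore] -/
def lmem (z : IVec) (l : List IVec) : Bool := l.any fun w => veq w z

/-- Determinant of the matrix with columns `a b c`. [folklore] -/
def det3 (a b c : IVec) : ℤ :=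
  a.1 * (b.2.1 * c.2.2 - b.2.2 * c.2.1) - b.1 * (a.2.1 * c.2.2 - a.2.2 * c.2.1) + c.1 * (a.2.1 * b.2.2 - a.2.2 * b.2.1)
/-- Cramer numerators `(λ₀, λ₁, λ₂)` with `λ₀ a + λ₁ b + λ₂ c = det3 a b c • w`. [folklore] -/
def cramer (a b c w : IVec) : IVec := (det3 w b c, det3 a w c, det3 a b w)

/-- The fcc two-shell pattern at scale `1/√18` (`3 · (fccInt ∪ fccSecondShellInt)`), as a list. [folklore] -/
def fccList : List IVec :=
  [(3, 3, 0), (3, -3, 0), (-3, 3, 0), (-3, -3, 0), (3, 0, 3), (3, 0, -3), (-3, 0, 3), (-3, 0, -3),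
   (0, 3, 3), (0, 3, -3), (0, -3, 3), (0, -3, -3), (6, 0, 0), (-6, 0, 0), (0, 6, 0), (0, -6, 0), (0, 0, 6), (0, 0, -6)]

/-- The hcp two-shell pattern at scale `1/√18` (`hcpInt ∪ hcpSecondShellInt`), as a list. [folklore] -/
def hcpList : List IVec :=
  [(3, -3, 0), (-3, 3, 0), (3, 0, -3), (-3, 0, 3), (0, 3, -3), (0, -3, 3), (3, 3, 0), (3, 0, 3), (0, 3, 3),
   (-1, -1, -4), (-1, -4, -1), (-4, -1, -1), (6, 0, 0), (0, 6, 0), (0, 0, 6), (2, -4, -4), (-4, 2, -4), (-4, -4, 2)]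

/-- The pattern list of a type (`false` = fcc, `true` = hcp). [folklore] -/
def modelList (hcp : Bool) : List IVec := if hcp then hcpList else fccList

/-! ### Letter contexts of the ideal Barlow template in the cuboctahedral frame -/

/-- A letter context: one of four coordinate sign flips (which `⟨111⟩` axis is the layer normal) and the letters
(`∈ {0,1,2}`, multiples of the hole offset) of layers `−2, −1, 1, 2`; layer `0` has letter `0`. [folklore] -/
structure Ctx where
  flip : Fin 4
  lm2 : ℤ
  lm1 : ℤ
  l1 : ℤ
  l2 : ℤ
deriving DecidableEq, Repr, Inhabited

/-- The sign flip of a context applied to a vector (involutive): `0` = identity, `k+1` negates coordinate `k`. [folklore] -/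
def flipVec (k : Fin 4) (z : IVec) : IVec :=
  match k with
  | 0 => z
  | 1 => (-(z.1), z.2.1, z.2.2)
  | 2 => (z.1, -(z.2.1), z.2.2)
  | 3 => (z.1, z.2.1, -(z.2.2))

/-- The letter of layer `m` (`none` outside `−2 … 2`). [folklore] -/
def Ctx.letter (κ : Ctx) (m : ℤ) : Option ℤ :=
  if m = -2 then some κ.lm2 else if m = -1 then some κ.lm1 else if m = 0 then some 0
  else if m = 1 then some κ.l1 else if m = 2 then some κ.l2 else none

/-- Site test: `z` (after the flip) is `barlowSiteInt m u v L` for some integers `u v`, with `m = Σz/6 ∈ [−2,2]` and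
`L` the context's letter of layer `m`:  `6 ∣ Σz`, `z₀ ≡ z₂ ≡ L + 2m (mod 3)`. [folklore] -/
def Ctx.isSite (κ : Ctx) (z : IVec) : Bool :=
  let z' := flipVec κ.flip z
  let S := z'.1 + z'.2.1 + z'.2.2
  S % 6 == 0 &&
    match κ.letter (S / 6) with
    | none => false
    | some L => (z'.1 - L - 2 * (S / 6)) % 3 == 0 && (z'.2.2 - L - 2 * (S / 6)) % 3 == 0

/-- Valid letter strings (consecutive letters differ; values in `{0,1,2}`). [folklore] -/
def Ctx.valid (κ : Ctx) : Bool :=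
  [κ.lm2, κ.lm1, κ.l1, κ.l2].all (fun L => 0 ≤ L && L ≤ 2) &&
    κ.lm2 != κ.lm1 && κ.lm1 != 0 && κ.l1 != 0 && κ.l1 != κ.l2

/-- All valid contexts. [folklore] -/
def allCtx : List Ctx :=
  (List.finRange 4).flatMap fun fl =>
    [0,1,2].flatMap fun a => [1,2].flatMap fun b => [1,2].flatMap fun c => [0,1,2].flatMap fun d =>
      let κ : Ctx := ⟨fl, a, b, c, d⟩
      if κ.valid then [κ] else []

/-- The site `(m,u,v)` with letter `L`, BEFORE the flip (same formula as `barlowSiteInt`). [folklore] -/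
def siteVec (m u v L : ℤ) : IVec := (3 * u + L + 2 * m, -(3 * u) - 3 * v - 2 * L + 2 * m, 3 * v + L + 2 * m)

/-- The sites of a context with `|m| ≤ 2`, `|u|,|v| ≤ 5` and norm ≤ `√(170/18) ≈ 3.07` (covers the two-shell
neighbourhood of every central site), in the frame of the
centre's pattern (i.e. after undoing the flip). [folklore] -/
def Ctx.sites (κ : Ctx) : List IVec :=
  [-2,-1,0,1,2].flatMap fun m =>
    match κ.letter m with
    | none => []
    | some L =>
      (List.range 11).flatMap fun iu => (List.range 11).flatMap fun iv =>
        let u : ℤ := iu - 5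
        let v : ℤ := iv - 5
        let z := siteVec m u v L
        if sq z ≤ 170 then [flipVec κ.flip z] else []

/-- Same underlying set, as lists (both directions of inclusion). [folklore] -/
def sameSet (l₁ l₂ : List IVec) : Bool := l₁.all (fun z => lmem z l₂) && l₂.all (fun z => lmem z l₁)

/-- The central sites (`0 < ‖·‖ ≤ √(40/18) ≈ 1.49`) of a context. [folklore] -/
def Ctx.central (κ : Ctx) : List IVec := κ.sites.filter fun z => 0 < sq z && sq z ≤ 40

/-- The contexts whose central 18 sites are exactly the centre's pattern. [folklore] -/
def ctxFor (hcpCentre : Bool) : List Ctx := allCtx.filter fun κ => sameSet κ.central (modelList hcpCentre)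


/-! ### The pair check (instance data: centre type, pivot `z0`, pivot type) -/

/-- The common particles' model points: `0` and the centre's pattern points at distance `1` (squared `18`) from `z0`. [folklore] -/
def commonsOf (cen : List IVec) (z0 : IVec) : List IVec :=
  (((0, 0, 0) : IVec) :: cen).filter fun c => sq (vsub c z0) == 18

/-- Ordered common triples with sides `(1, 1, √(d13/18))` that span together with `z0`. [folklore] -/
def triplesOf (cs : List IVec) (z0 : IVec) (d13 : ℤ) : List (IVec × IVec × IVec) :=
  cs.flatMap fun a => cs.flatMap fun b => cs.flatMap fun c =>
    if sq (vsub a b) == 18 && sq (vsub b c) == 18 && sq (vsub a c) == d13 &&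
        det3 (vsub a z0) (vsub b z0) (vsub c z0) != 0 then [(a, b, c)] else []

/-- The designated common triple: an all-unit spanning triple if there is one, else a `(1,1,√2)` one. [folklore] -/
def designated (cen : List IVec) (z0 : IVec) : Option (IVec × IVec × IVec) :=
  let cs := commonsOf cen z0
  match (triplesOf cs z0 18).head? with
  | some t => some t
  | none => (triplesOf cs z0 36).head?

/-- Label triples of the pivot's pattern compatible with the coarse distance classes of the designated triple
(all norms `1`; consecutive distances `1`; the third side `1` if `d13 = 18`, else squared model distance
`36, 48 or 54` (`√2`, `2√6/3`, `√3`): the metric window around `√2` is `(1.135, 1.724)`, which contains `2√6/3 ≈ 1.633`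
(hcp labels) and misses `√3` only by `0.008`, so both are admitted and must be refuted combinatorially). [folklore] -/
def admissibleLabels (piv : List IVec) (d13 : ℤ) : List (IVec × IVec × IVec) :=
  let units := piv.filter fun w => sq w == 18
  let nbrs : IVec → List IVec := fun w => units.filter fun w' => sq (vsub w w') == 18
  units.flatMap fun w1 => (nbrs w1).flatMap fun w2 => (nbrs w2).flatMap fun w3 =>
    if (if d13 == 18 then sq (vsub w1 w3) == 18 else
          (sq (vsub w1 w3) == 36 || sq (vsub w1 w3) == 48 || sq (vsub w1 w3) == 54))
    then [(w1, w2, w3)] else []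

/-- `Σ |zᵢ|` for a coefficient vector. [folklore] -/
def l1 (z : IVec) : ℤ := |z.1| + |z.2.1| + |z.2.2|

/-- Image (times `d = det3 w1 w2 w3`) of the label `w` under the linear map `wₖ ↦ cₖ'`:
`Σ (cramer w1 w2 w3 w)ₖ • cₖ'`. [folklore] -/
def imgD (w1 w2 w3 c1 c2 c3 w : IVec) : IVec :=
  let l := cramer w1 w2 w3 w
  vadd (vadd (vsmul l.1 c1) (vsmul l.2.1 c2)) (vsmul l.2.2 c3)

/-- Crude placement constant (times `20·47·|d|`): `47·|d − Σλ| + 97·Σ|λ|` (tolerances `1/20` for the pivot's own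
position and `(1+s)/20 ≤ 97/940` per common, `s ≤ 50/47`). [folklore] -/
def ecrD (w1 w2 w3 w : IVec) : ℤ :=
  let l := cramer w1 w2 w3 w
  47 * |det3 w1 w2 w3 - (l.1 + l.2.1 + l.2.2)| + 97 * l1 l

/-- A small integer relation `α w1 + β w2 + γ w3 = 0` (coefficients in `[−2,2]`, not all zero), if any. [folklore] -/
def relationOf (w1 w2 w3 : IVec) : Option IVec :=
  let R : List ℤ := [-2, -1, 0, 1, 2]
  (R.flatMap fun a => R.flatMap fun b => R.flatMap fun c =>
    if (a != 0 || b != 0 || c != 0) &&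
        veq (vadd (vadd (vsmul a w1) (vsmul b w2)) (vsmul c w3)) (0, 0, 0) then [((a, b, c) : IVec)] else []).head?

/-- The verdict on one admissible label triple.  `ctxs` = contexts of the centre type, `cen`/`piv` the two patterns,
`z0` the pivot, `(c1,c2,c3)` the designated commons.  TRUE iff the metric hypotheses of the pair lemma are
contradictory for this triple (dependent with a short far-from-zero relation; or a common / the centre's
completeness is violated beyond the crude placement error), or the Cramer placement is LOCALLY ACCEPTED
(isometric on the pattern, containing every common exactly, and with every image inside the `1.49`-ball equal to a
pattern point or the centre). [folklore] -/
def tripleVerdict (cen piv : List IVec) (z0 c1 c2 c3 w1 w2 w3 : IVec) : Bool :=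
  let d := det3 w1 w2 w3
  let c1' := vsub c1 z0
  let c2' := vsub c2 z0
  let c3' := vsub c3 z0
  if d == 0 then
    match relationOf w1 w2 w3 with
    | none => false
    | some r =>
      -- ‖Σ rₖ cₖ'‖ would be ≤ (Σ|rₖ|)·(2+s)/20 ≤ (Σ|rₖ|)·36/235: refuted iff 235²·sq > 18·36²·(Σ|r|)²
      let v := vadd (vadd (vsmul r.1 c1') (vsmul r.2.1 c2')) (vsmul r.2.2 c3')
      55225 * sq v > 23328 * (l1 r) ^ 2
  else
    let T : IVec → IVec := fun w => imgD w1 w2 w3 c1' c2' c3' w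
    let P : IVec → IVec := fun w => vadd (vsmul d z0) (T w)
    -- locally accepted: the placement is isometric on the pattern and EXACTLY consistent with the commons and
    -- with the centre's completeness (fake "tilted" placements pass here and are removed by the pair constraints)
    let cen0 : List IVec := ((0, 0, 0) : IVec) :: cen
    let isometric : Bool := piv.all fun w => sq (T w) == d ^ 2 * sq w &&
      piv.all fun w' => sq (vsub (T w) (T w')) == d ^ 2 * sq (vsub w w')
    let exactC2 : Bool := (commonsOf cen z0).all fun c => piv.any fun w => veq (T w) (vsmul d (vsub c z0))
    let exactC3 : Bool := piv.all fun w => !(sq (P w) ≤ 40 * d ^ 2) || cen0.any fun c => veq (P w) (vsmul d c)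
    let accepted : Bool := isometric && exactC2 && exactC3
    -- rejected by a common: its particle's prediction would be too far from every image
    let rejC2 : Bool := (commonsOf cen z0).any fun c => piv.all fun w =>
      940 ^ 2 * sq (vsub (P w) (vsmul d c)) > 18 * (ecrD w1 w2 w3 w + 97 * |d|) ^ 2
    -- rejected by the centre's completeness: some image's particle lies inside the 3/2-ball and far from the pattern
    let rejC3 : Bool := piv.any fun w =>
      let R := 1360 * |d| - ecrD w1 w2 w3 w
      (0 ≤ R) && (940 ^ 2 * sq (P w) ≤ 18 * R ^ 2) &&
        (cen0.all fun c =>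
          940 ^ 2 * sq (vsub (P w) (vsmul d c)) > 18 * (ecrD w1 w2 w3 w + 97 * |d|) ^ 2)
    accepted || rejC2 || rejC3

/-- **The pair check** for centre type `cenHcp`, pivot `z0` (a vector of the centre's pattern) and pivot type
`pivHcp`: a designated common triple exists and every admissible label triple has a TRUE verdict. [folklore] -/
def checkPair (cenHcp pivHcp : Bool) (z0 : IVec) : Bool :=
  let cen := modelList cenHcp
  let piv := modelList pivHcp
  match designated cen z0 with
  | none => false
  | some (c1, c2, c3) =>
    (admissibleLabels piv (sq (vsub c1 c3))).all fun t => tripleVerdict cen piv z0 c1 c2 c3 t.1 t.2.1 t.2.2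

end Literature.Geometry.DiscreteGeometry.TwoShellCheck
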